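import Literature.MathematicalPhysics.QuantumFieldTheory.Balaban1983to89.Beta.GaussianIntegral
import Literature.MathematicalPhysics.QuantumFieldTheory.Balaban1983to89.B1Sect3Statements
import Literature.MathematicalPhysics.QuantumFieldTheory.Balaban1983to89.B1RT

/-!
# `Balaban1983to89.B1GaussNorm331` — T. Bałaban, *(Higgs)₂,₃ quantum fields in a finite volume. I. A lower bound*,
Commun. Math. Phys. **85** (1982) 603–626 [Balaban1982Higgs1]: the Gaussian normalisations `Z_k` (3.31) and
`Z_k(A^{(k),ε})` (3.32) of the k-th effective action (3.30), DEFINED AS PRINTED, with their finite-dimensional closed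
form `Z_k = (a_k(L^kε)^{d−2})^{(d/2)|T₁^{(k)}|}(det (G^ε_k)⁻¹)^{−1/2}` PROVED from the tree's Gaussian-integral theorem

statement-level skeleton of published theorems with citation tags; proofs where landed; nothing here is a claim about the Yang–Mills mass gap

PDF held: `paper:balaban1982-cmp85-higgs23-i` (journal page = PDF page + 602); the displays were read on the x2 renders
`run/shared/lean/pub/pub-balaban/b2b-balaban-ref1/pages/1982-cmp85-higgs23-I/1982-cmp85-higgs23-I-p015-x2.png` (p. 617)
and `…-p017-x2.png` (p. 619), READ AS IMAGES.

CITATION HEADER (lean-in-tree rule).  WHAT IS REPRODUCED, verbatim, p. 617 [PDF 15]: *"The action has the form: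
S^{(k),L^kε}(A, φ) = −log Z_k − log Z_k(A^{(k),ε}) + ½⟨A, Δ^{(k),L^kε}A⟩ + ½⟨φ, Δ^{(k),L^kε}(A^{(k),ε})φ⟩
− 𝒫^{(k),L^kε}(A^{(k),ε}, φ) + E₀, (3.30) and for the factors Z_k, Z_k(A^{(k),ε}) we have the formulas:
Z_k = (a_k(L^kε)^{d−2}/2π)^{(d/2)|T₁^{(k)}|} ∫dA exp(−½⟨A, (G^ε_k)⁻¹A⟩), (3.31)
Z_k(A^{(k),ε}) = (a_k(L^kε)^{d−2}/2π)^{(N/2)|T₁^{(k)}|} ∫dφ exp(−½⟨φ, (G^ε_k(A^{(k),ε}))⁻¹φ⟩). (3.32)"*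
— SKELETON row **B1.Eq3.31-3.32** (Phase-2 seat p12, lead ruling G.5-14/G.5-21: "DEFINE as printed over the
`B1Sect3Statements` carriers + PROVE the finite-dimensional Gaussian closed form").  The context p. 617: *"We assume that
after k renormalization transformations we get an action S^{(k),L^kε}(A, φ) for the fields A, φ on L^kε-lattice
T^{(k)}_{L^kε}"* — `A` a `d`-component (vector) field and `φ` an `N`-component field on the `|T₁^{(k)}|` sites, whence the
exponents `(d/2)|T₁^{(k)}|`, `(N/2)|T₁^{(k)}|` = half the number of real integration variables.

THE MODEL (the schematic style of `…B1Sect3Statements`, cell DIVERGENCE D-b01.3: abstract finite site types, operators the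
paper defines elsewhere as explicit arguments).  Sites `T` (↤ `T₁^{(k)}`, finite); the field `A` ↦ a point of
`T × Fin d → ℝ`, `φ` ↦ a point of `T × Fin N → ℝ`; `dA`, `dφ` = Lebesgue (= product) measure `volume`; the quadratic
forms `⟨A, (G^ε_k)⁻¹A⟩`, `⟨φ, (G^ε_k(A^{(k),ε}))⁻¹φ⟩` ↦ `A ⬝ᵥ Ginv *ᵥ A`, `φ ⬝ᵥ GinvA *ᵥ φ` for real matrices `Ginv`,
`GinvA` on those index types — THE MATRICES OF THE PRINTED FORMS IN THE INTEGRATION COORDINATES (they absorb the lattice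
weight `(L^kε)^d` of the scalar product `⟨·,·⟩` and the operators `(G^ε_k)⁻¹`, `(G^ε_k(A^{(k),ε}))⁻¹` of (3.15)–(3.16),
which this file does not construct); `a_k(L^kε)^{d−2}` ↦ `B1RT.prec ak ℓ d = ak·ℓ^{d−2}` (integer exponent, r14's carrier
of the printed precision), `ℓ = L^kε`.  Positivity of `G^ε_k`, `G^ε_k(A^{(k),ε})` (the paper's standing fact from
Proposition 3.1/(3.15)) is the HYPOTHESIS `Matrix.PosDef` of the closed-form theorems, displayed.

WHAT THIS FILE PROVES (kernel-checked, 0 `sorry`, standard axioms; the Gaussian integral itself is the tree's KERNEL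
theorem `Beta.GaussianIntegral.integral_exp_neg_half_quadForm` — `∫_{ι→ℝ} exp(−½vᵀMv) dv = √(2π)^{|ι|}/√(det M)` for
`M` positive definite — RE-USED BY NAME, not restated; cf. `B14.GaussianDet333` (r11 g2) for B14 (3.33) on the same kernel):
* `gaussNorm c M := (c/2π)^{|ι|/2} ∫ exp(−½ vᵀMv) dv` — the common shape of (3.31)/(3.32) — and **`gaussNorm_eq`**:
  `gaussNorm c M = c^{|ι|/2}/√(det M)` (`c ≥ 0`, `M` positive definite): THE `2π`'s CANCEL EXACTLY against the printed
  prefactor; `gaussNorm_pos`, **`log_gaussNorm`**: `log gaussNorm c M = (|ι|/2)·log c − ½·log det M`; `gaussNorm_integrable`.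
* (3.31) `Zk`, (3.32) `ZkA` DEFINED AS PRINTED (printed exponents `(d/2)|T₁^{(k)}|`, `(N/2)|T₁^{(k)}|`); `Zk_eq_gaussNorm`,
  `ZkA_eq_gaussNorm` (`|T × Fin d| = d|T|`); **`Zk_eq`**, **`ZkA_eq`**: `Z_k = (a_k(L^kε)^{d−2})^{(d/2)|T₁^{(k)}|}/√det Ginv`,
  `Z_k(A^{(k),ε}) = (a_k(L^kε)^{d−2})^{(N/2)|T₁^{(k)}|}/√det GinvA`; `Zk_pos`, `ZkA_pos`; **`log_Zk`**, **`log_ZkA`** — the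
  two constants `−log Z_k − log Z_k(A^{(k),ε})` of (3.30) in closed form — and the dictionary `action330_logZ` into
  `B1Sect3Statements.action330`.
HONEST SCOPE.  (i) `Ginv`, `GinvA` are arguments: the operators `G^ε_k = G_k(T^{(k)}, 0)`, `G^ε_k(A^{(k),ε})` of (3.15)–(3.16)
/(3.29) and their positivity are not constructed here (the kernel-checked resolvent algebra of (3.15)–(3.16) is
`B1.display315`/`display316`).  (ii) The RESCALED forms (3.39)–(3.40) p. 619 (row B1.Eq3.39-3.40) are not typed here;
note for that row: with `⟨φ,ψ⟩ = η^dΣφψ` and `dφ = Π dφ(x)` the Gaussian integral is `(2π/η^d)^{½N|T₁|}(det G⁻¹)^{−1/2}`,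
so the printed factor `(2πη^d)^{−½N|T₁|}` of (3.40) is to be re-read by that row's seat (recorded in HOME/GAPS.md, not
asserted here).  (iii) No measure-theoretic identification of `dA` on the lattice beyond "Lebesgue on the coordinates".
Unit `lit-balaban-p12` (Phase-2 seat p12), HOME `run/shared/lean/pub/lit-balaban/` (seat log `lit-balaban-p12/STATUS.md`).
-/

noncomputable section

open MeasureTheory Matrix Finset
open scoped Real

namespace Literature.MathematicalPhysics.QuantumFieldTheory.Balaban1983to89.B1GaussNorm331

open Literature.MathematicalPhysics.QuantumFieldTheory.Balaban1983to89

/-! ## §1 The normalised Gaussian constant `(c/2π)^{|ι|/2} ∫ exp(−½ vᵀMv) dv` and its closed form -/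

section Generic

variable {ι : Type*} [Fintype ι] [DecidableEq ι]

omit [DecidableEq ι] in
/-- **the common shape of (3.31)/(3.32)**: `(c/2π)^{|ι|/2} ∫_{ι→ℝ} dv exp(−½ vᵀMv)` — printed prefactor base
`c = a_k(L^kε)^{d−2}`, exponent `(d/2)|T₁^{(k)}|` resp. `(N/2)|T₁^{(k)}|` = half the number `|ι|` of real integration
variables, `M` the matrix of the quadratic form `⟨·,(G)⁻¹·⟩` in the integration coordinates.
[cite: Balaban1982Higgs1, (3.31)–(3.32) p.617] -/
def gaussNorm (c : ℝ) (M : Matrix ι ι ℝ) : ℝ :=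
  (c / (2 * π)) ^ ((Fintype.card ι : ℝ) / 2) * ∫ v : ι → ℝ, Real.exp (-(1 / 2 : ℝ) * (v ⬝ᵥ M *ᵥ v))

omit [DecidableEq ι] in
/-- `gaussNorm` unfolded. [cite: Balaban1982Higgs1, (3.31)–(3.32) p.617] -/
theorem gaussNorm_def (c : ℝ) (M : Matrix ι ι ℝ) :
    gaussNorm c M = (c / (2 * π)) ^ ((Fintype.card ι : ℝ) / 2)
      * ∫ v : ι → ℝ, Real.exp (-(1 / 2 : ℝ) * (v ⬝ᵥ M *ᵥ v)) := rfl

/-- the Gaussian weight of (3.31)/(3.32) is integrable for a positive definite form (the integral is a genuine Lebesgue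
integral, not a junk value) — the tree's `Beta.GaussianIntegral.integrable_exp_neg_half_quadForm`, BY NAME.
[cite: Balaban1982Higgs1, (3.31)–(3.32) p.617] -/
theorem gaussNorm_integrable {M : Matrix ι ι ℝ} (hM : M.PosDef) :
    Integrable (fun v : ι → ℝ => Real.exp (-(1 / 2 : ℝ) * (v ⬝ᵥ M *ᵥ v))) :=
  Beta.GaussianIntegral.integrable_exp_neg_half_quadForm M hM

/-- **THE CLOSED FORM**: `(c/2π)^{|ι|/2} ∫ exp(−½ vᵀMv) dv = c^{|ι|/2} / √(det M)` for `c ≥ 0` and `M` positive definite —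
the printed `(·/2π)^{n/2}` cancels the `(2π)^{n/2}` of the Gaussian integral exactly (the tree's kernel theorem
`Beta.GaussianIntegral.integral_exp_neg_half_quadForm`: `∫ exp(−½ vᵀMv) dv = √(2π)^{|ι|}/√(det M)`).
[cite: Balaban1982Higgs1, (3.31)–(3.32) p.617] -/
theorem gaussNorm_eq {c : ℝ} (hc : 0 ≤ c) {M : Matrix ι ι ℝ} (hM : M.PosDef) :
    gaussNorm c M = c ^ ((Fintype.card ι : ℝ) / 2) / Real.sqrt M.det := by
  rw [gaussNorm, Beta.GaussianIntegral.integral_exp_neg_half_quadForm M hM]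
  have h2π : (0 : ℝ) ≤ 2 * π := by positivity
  have hsq : Real.sqrt (2 * π) ^ Fintype.card ι = (2 * π) ^ ((Fintype.card ι : ℝ) / 2) := by
    rw [Real.sqrt_eq_rpow, ← Real.rpow_natCast, ← Real.rpow_mul h2π]
    ring_nf
  rw [hsq, mul_div_assoc', ← Real.mul_rpow (div_nonneg hc h2π) h2π, div_mul_cancel₀ c (by positivity)]

/-- positivity of the normalised Gaussian constant (`c > 0`, `M` positive definite). [cite: Balaban1982Higgs1, (3.31)–(3.32) p.617] -/
theorem gaussNorm_pos {c : ℝ} (hc : 0 < c) {M : Matrix ι ι ℝ} (hM : M.PosDef) : 0 < gaussNorm c M := by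
  rw [gaussNorm_eq hc.le hM]
  exact div_pos (Real.rpow_pos_of_pos hc _) (Real.sqrt_pos.2 hM.det_pos)

/-- **log form** (what enters (3.30) as `−log Z`): `log[(c/2π)^{|ι|/2} ∫ exp(−½ vᵀMv) dv] = (|ι|/2)·log c − ½·log det M`.
[cite: Balaban1982Higgs1, (3.30)–(3.32) p.617] -/
theorem log_gaussNorm {c : ℝ} (hc : 0 < c) {M : Matrix ι ι ℝ} (hM : M.PosDef) :
    Real.log (gaussNorm c M) = (Fintype.card ι : ℝ) / 2 * Real.log c - (1 / 2 : ℝ) * Real.log M.det := by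
  rw [gaussNorm_eq hc.le hM, Real.log_div (Real.rpow_pos_of_pos hc _).ne' (Real.sqrt_pos.2 hM.det_pos).ne',
    Real.log_rpow hc, Real.log_sqrt hM.det_pos.le]
  ring

end Generic

/-! ## §2 (3.31) `Z_k` and (3.32) `Z_k(A^{(k),ε})`, as printed -/

section Printed

variable {T : Type*} [Fintype T] [DecidableEq T]

omit [DecidableEq T] in
/-- **(3.31)** p. 617, verbatim: *"Z_k = (a_k(L^kε)^{d−2}/2π)^{(d/2)|T₁^{(k)}|} ∫dA exp(−½⟨A, (G^ε_k)⁻¹A⟩), (3.31)"* —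
typed reading: `T` ↤ the sites `T₁^{(k)}`, `A : T × Fin d → ℝ` the `d`-component vector field, `dA` = Lebesgue measure,
`a_k(L^kε)^{d−2}` = `B1RT.prec ak ℓ d` (`ℓ = L^kε`), `⟨A,(G^ε_k)⁻¹A⟩ = A ⬝ᵥ Ginv *ᵥ A` with `Ginv` the matrix of the printed
form in these coordinates (carrier clause: the weight `(L^kε)^d` of `⟨·,·⟩` and the operator `(G^ε_k)⁻¹` of (3.15) live
inside `Ginv`). [cite: Balaban1982Higgs1, (3.31) p.617] -/
def Zk (d : ℕ) (ak ℓ : ℝ) (Ginv : Matrix (T × Fin d) (T × Fin d) ℝ) : ℝ :=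
  (B1RT.prec ak ℓ d / (2 * π)) ^ ((d : ℝ) / 2 * (Fintype.card T : ℝ))
    * ∫ A : T × Fin d → ℝ, Real.exp (-(1 / 2 : ℝ) * (A ⬝ᵥ Ginv *ᵥ A))

omit [DecidableEq T] in
/-- **(3.32)** p. 617, verbatim: *"Z_k(A^{(k),ε}) = (a_k(L^kε)^{d−2}/2π)^{(N/2)|T₁^{(k)}|} ∫dφ exp(−½⟨φ, (G^ε_k(A^{(k),ε}))⁻¹φ⟩).
(3.32)"* — typed reading: `φ : T × Fin N → ℝ` the `N`-component field, `dφ` = Lebesgue measure, `GinvA` the matrix of the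
printed form `⟨φ,(G^ε_k(A^{(k),ε}))⁻¹φ⟩` in these coordinates (the background `A^{(k),ε}` enters only through `GinvA`).
[cite: Balaban1982Higgs1, (3.32) p.617] -/
def ZkA (d N : ℕ) (ak ℓ : ℝ) (GinvA : Matrix (T × Fin N) (T × Fin N) ℝ) : ℝ :=
  (B1RT.prec ak ℓ d / (2 * π)) ^ ((N : ℝ) / 2 * (Fintype.card T : ℝ))
    * ∫ φ : T × Fin N → ℝ, Real.exp (-(1 / 2 : ℝ) * (φ ⬝ᵥ GinvA *ᵥ φ))

omit [DecidableEq T] in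
/-- (3.31) is the normalised Gaussian constant of §1 on the `d|T₁^{(k)}|` real variables of `A` (the printed exponent
`(d/2)|T₁^{(k)}|` is `|T × Fin d|/2`). [cite: Balaban1982Higgs1, (3.31) p.617] -/
theorem Zk_eq_gaussNorm (d : ℕ) (ak ℓ : ℝ) (Ginv : Matrix (T × Fin d) (T × Fin d) ℝ) :
    Zk d ak ℓ Ginv = gaussNorm (B1RT.prec ak ℓ d) Ginv := by
  rw [Zk, gaussNorm, Fintype.card_prod, Fintype.card_fin]
  push_cast
  ring_nf

omit [DecidableEq T] in
/-- (3.32) is the normalised Gaussian constant of §1 on the `N|T₁^{(k)}|` real variables of `φ`.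
[cite: Balaban1982Higgs1, (3.32) p.617] -/
theorem ZkA_eq_gaussNorm (d N : ℕ) (ak ℓ : ℝ) (GinvA : Matrix (T × Fin N) (T × Fin N) ℝ) :
    ZkA d N ak ℓ GinvA = gaussNorm (B1RT.prec ak ℓ d) GinvA := by
  rw [ZkA, gaussNorm, Fintype.card_prod, Fintype.card_fin]
  push_cast
  ring_nf

/-- **(3.31) IN CLOSED FORM**: for `a_k ≥ 0`, `L^kε > 0` and a positive definite form,
`Z_k = (a_k(L^kε)^{d−2})^{(d/2)|T₁^{(k)}|} / √det Ginv` — the finite-dimensional Gaussian integral evaluated (the shape of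
the rescaled (3.39)–(3.40), p. 619). [cite: Balaban1982Higgs1, (3.31) p.617] -/
theorem Zk_eq (d : ℕ) {ak ℓ : ℝ} (hak : 0 ≤ ak) (hℓ : 0 < ℓ) {Ginv : Matrix (T × Fin d) (T × Fin d) ℝ}
    (hG : Ginv.PosDef) :
    Zk d ak ℓ Ginv = B1RT.prec ak ℓ d ^ ((d : ℝ) / 2 * (Fintype.card T : ℝ)) / Real.sqrt Ginv.det := by
  have hc : 0 ≤ B1RT.prec ak ℓ d := mul_nonneg hak (zpow_pos hℓ _).le
  rw [Zk_eq_gaussNorm, gaussNorm_eq hc hG, Fintype.card_prod, Fintype.card_fin]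
  push_cast
  ring_nf

/-- **(3.32) IN CLOSED FORM**: `Z_k(A^{(k),ε}) = (a_k(L^kε)^{d−2})^{(N/2)|T₁^{(k)}|} / √det GinvA`.
[cite: Balaban1982Higgs1, (3.32) p.617] -/
theorem ZkA_eq (d N : ℕ) {ak ℓ : ℝ} (hak : 0 ≤ ak) (hℓ : 0 < ℓ) {GinvA : Matrix (T × Fin N) (T × Fin N) ℝ}
    (hG : GinvA.PosDef) :
    ZkA d N ak ℓ GinvA = B1RT.prec ak ℓ d ^ ((N : ℝ) / 2 * (Fintype.card T : ℝ)) / Real.sqrt GinvA.det := by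
  have hc : 0 ≤ B1RT.prec ak ℓ d := mul_nonneg hak (zpow_pos hℓ _).le
  rw [ZkA_eq_gaussNorm, gaussNorm_eq hc hG, Fintype.card_prod, Fintype.card_fin]
  push_cast
  ring_nf

/-- `Z_k > 0` (so `log Z_k` in (3.30) is the logarithm of a positive number). [cite: Balaban1982Higgs1, (3.30)–(3.31) p.617] -/
theorem Zk_pos (d : ℕ) {ak ℓ : ℝ} (hak : 0 < ak) (hℓ : 0 < ℓ) {Ginv : Matrix (T × Fin d) (T × Fin d) ℝ}
    (hG : Ginv.PosDef) : 0 < Zk d ak ℓ Ginv := by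
  rw [Zk_eq_gaussNorm]
  exact gaussNorm_pos (B1RT.prec_pos hak hℓ d) hG

/-- `Z_k(A^{(k),ε}) > 0`. [cite: Balaban1982Higgs1, (3.30)–(3.32) p.617] -/
theorem ZkA_pos (d N : ℕ) {ak ℓ : ℝ} (hak : 0 < ak) (hℓ : 0 < ℓ) {GinvA : Matrix (T × Fin N) (T × Fin N) ℝ}
    (hG : GinvA.PosDef) : 0 < ZkA d N ak ℓ GinvA := by
  rw [ZkA_eq_gaussNorm]
  exact gaussNorm_pos (B1RT.prec_pos hak hℓ d) hG

/-- **`log Z_k`**, the first constant of (3.30): `log Z_k = (d|T₁^{(k)}|/2)·log(a_k(L^kε)^{d−2}) − ½·log det Ginv`.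
[cite: Balaban1982Higgs1, (3.30)–(3.31) p.617] -/
theorem log_Zk (d : ℕ) {ak ℓ : ℝ} (hak : 0 < ak) (hℓ : 0 < ℓ) {Ginv : Matrix (T × Fin d) (T × Fin d) ℝ}
    (hG : Ginv.PosDef) :
    Real.log (Zk d ak ℓ Ginv)
      = (d : ℝ) * (Fintype.card T : ℝ) / 2 * Real.log (B1RT.prec ak ℓ d) - (1 / 2 : ℝ) * Real.log Ginv.det := by
  rw [Zk_eq_gaussNorm, log_gaussNorm (B1RT.prec_pos hak hℓ d) hG, Fintype.card_prod, Fintype.card_fin]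
  push_cast
  ring_nf

/-- **`log Z_k(A^{(k),ε})`**, the second constant of (3.30): `(N|T₁^{(k)}|/2)·log(a_k(L^kε)^{d−2}) − ½·log det GinvA`.
[cite: Balaban1982Higgs1, (3.30)–(3.32) p.617] -/
theorem log_ZkA (d N : ℕ) {ak ℓ : ℝ} (hak : 0 < ak) (hℓ : 0 < ℓ) {GinvA : Matrix (T × Fin N) (T × Fin N) ℝ}
    (hG : GinvA.PosDef) :
    Real.log (ZkA d N ak ℓ GinvA)
      = (N : ℝ) * (Fintype.card T : ℝ) / 2 * Real.log (B1RT.prec ak ℓ d) - (1 / 2 : ℝ) * Real.log GinvA.det := by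
  rw [ZkA_eq_gaussNorm, log_gaussNorm (B1RT.prec_pos hak hℓ d) hG, Fintype.card_prod, Fintype.card_fin]
  push_cast
  ring_nf

/-- **dictionary into (3.30)** (`B1Sect3Statements.action330`, whose first two constituents are the reals `log Z_k`,
`log Z_k(A^{(k),ε})`): with the printed normalisations (3.31)–(3.32) in closed form, the action reads
`S = −(d|T|/2 + N|T|/2)·log(a_k(L^kε)^{d−2}) + ½ log det Ginv + ½ log det GinvA + ½⟨A,ΔA⟩ + ½⟨φ,Δ(A)φ⟩ − 𝒫 + E₀`.
[cite: Balaban1982Higgs1, (3.30)–(3.32) p.617] -/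
theorem action330_logZ (d N : ℕ) {ak ℓ : ℝ} (hak : 0 < ak) (hℓ : 0 < ℓ)
    {Ginv : Matrix (T × Fin d) (T × Fin d) ℝ} (hG : Ginv.PosDef)
    {GinvA : Matrix (T × Fin N) (T × Fin N) ℝ} (hGA : GinvA.PosDef) (formA formφ P E₀ : ℝ) :
    B1Sect3Statements.action330 (Real.log (Zk d ak ℓ Ginv)) (Real.log (ZkA d N ak ℓ GinvA)) formA formφ P E₀
      = -(((d : ℝ) + N) * (Fintype.card T : ℝ) / 2 * Real.log (B1RT.prec ak ℓ d))
        + (1 / 2 : ℝ) * Real.log Ginv.det + (1 / 2 : ℝ) * Real.log GinvA.det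
        + 1 / 2 * formA + 1 / 2 * formφ - P + E₀ := by
  rw [B1Sect3Statements.action330, log_Zk d hak hℓ hG, log_ZkA d N hak hℓ hGA]
  ring

end Printed

end Literature.MathematicalPhysics.QuantumFieldTheory.Balaban1983to89.B1GaussNorm331

end
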